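import Mathlib
import Summits.Ventures.HodgeRepro2.Tier7.Line3.CompactTorusFactorBound

/-!
# Tier7/Line3/CompactPlaceFactor — the three per-place clauses at a place of `S` (compact tori)
(seat t7-x1, gen 4; the per-place input of LocalFactorProduct at the places of `S`)

LINE 3 (t7-plan-3), version (ii). LocalFactorProduct takes, at each place `w ≠ v₁`, a local factor with three clauses
(support / bound / non-vanishing at `γ₀`). At a place of `S` — where the tori are COMPACT and the test function is the
indicator of a compact open — CompactTorusFactorBound p678241 (row U2) already proves the bound `‖b γ‖ ≤ vol` for EVERY
`γ` and `b γ₀ ≠ 0` from p1's positivity row (T7SupportLocalFactorPositive p664522). This module packages the two halves in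
LocalFactorProduct's per-place binder shape: `compactFactor_clauses` with `arith := fun _ => True` (the bound holds on
all of `Orb`, so the support clause is vacuous), `C := vol / ‖b γ₀‖`, any exponent `ε ≥ 0` (the place contributes no
growth: `ε = 0`). DICTIONARY (in words): `w ∈ S`, `T = T_A(E⁺_w) × T_B(E⁺_w)` compact with its Haar measure `μ`, `W = K_w`
(or the level set), `act γ (t, t′) = t⁻¹ γ t′`, `χ = μ_{A,w} ⊗ μ_{B,w}⁻¹`, and the open set `U` on which the integrand at
`γ₀` is `1` (the characters trivial on a small open piece of the orbit of `γ₀` — p1's row). Nothing here is about (N),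
(P), the real `X`, or HC_CM; §8(d): NO. Blind lane: Mathlib + the HodgeRepro2 prefix; no sorry;
axioms ⊆ {propext, Classical.choice, Quot.sound}.
-/

namespace Summit.Ventures.HodgeRepro2.Tier7.Line3.CompactPlaceFactor

open MeasureTheory Summit.Ventures.HodgeRepro2.Tier7.Line3.CompactTorusFactorBound

variable {T : Type*} [MeasurableSpace T] (μ : Measure T) [IsFiniteMeasure μ]
  [TopologicalSpace T] [OpensMeasurableSpace T] [μ.IsOpenPosMeasure]
  {X Orb : Type*} (W : Set X) (act : Orb → T → X) (χ : T → ℂ)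

/-- the local factor at a place of `S`: the orbital integral over the compact tori. -/
noncomputable def compactFactor (γ : Orb) : ℂ := ∫ t, orbital W (act γ) χ t ∂μ

/-- **the three per-place clauses at a place of `S`**, in LocalFactorProduct's binder shape (`arith := fun _ => True`,
`C := vol / ‖b γ₀‖`, exponent `ε ≥ 0` arbitrary — take `0`). -/
theorem compactFactor_clauses (hχ : ∀ t, ‖χ t‖ = 1) (γ₀ : Orb) (U : Set T) (hU : IsOpen U) (hne : U.Nonempty)
    (hfin : μ U ≠ ⊤)
    (hγ₀ : ∫ t, orbital W (act γ₀) χ t ∂μ = ∫ t, U.indicator (fun _ => (1 : ℂ)) t ∂μ)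
    (size : Orb → ℝ) (hsize : ∀ γ, 0 ≤ size γ) {ε : ℝ} (hε : 0 ≤ ε) :
    (∀ γ, compactFactor μ W act χ γ ≠ 0 → True) ∧
    (∀ γ, True → ‖compactFactor μ W act χ γ‖ ≤
      (μ.real Set.univ / ‖compactFactor μ W act χ γ₀‖) * (1 + size γ) ^ ε * ‖compactFactor μ W act χ γ₀‖) ∧
    compactFactor μ W act χ γ₀ ≠ 0 := by
  obtain ⟨h0, hb⟩ := exists_b_bound_of_compact_tori μ W act χ hχ γ₀ U hU hne hfin hγ₀ size hsize hε
  exact ⟨fun _ _ => trivial, fun γ _ => hb γ, h0⟩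

end Summit.Ventures.HodgeRepro2.Tier7.Line3.CompactPlaceFactor
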